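import Literature.Claims.NS.Smith2006

/-!
# D-0090 NS-CLAIMS, claim C06 `Smith2006` — kernel countermodels to typed steps

Cell `ns-claims`; refuter `ns-claims-refuter-3` (typist `ns-claims-typist-6`, referee `ns-claims-ref-2`).
Every theorem here NEGATES a `def … : Prop` of `Literature.Claims.NS.Smith2006` (P. Smith, arXiv:math/0609740
v4, withdrawn v5) by an explicit witness; nothing is asserted about the Navier–Stokes system.

## `not_Theorem2Barriers` — Step 2 as printed (Thm 2 (1)–(4), pp. 3–4, l. 266–317; LITERAL item (3):
ONE barrier pair serves every `λ ∈ (0, 1/4)`)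

Initial-layer obstruction at `t = t̂`. The `Υᵢⱼ`-row of system (6) is `λ ∂ₜΥᵢⱼ − ∂ⱼvᵢ + Υᵢⱼ`
(`auxResidualΥ`). Take `t̂ = 0`, `S = [0, ∞)` (`isTimeSlab_Ici`), `F = 0` (`AuxForce.isAdmissible_zero`) and
the admissible datum `W₀ = (0, 0, Υ₀)` with all nine `Υ₀ᵢⱼ = −β`, `β` a smooth bump equal to `1` near the
origin (Mathlib `ContDiffBump`; compactly supported, hence `C^∞ ∩ H^∞`). If `V^#` is C² with
`V^#(0, ·) = W₀` and a supersolution for EVERY `λ ∈ (0, 1/4)`, then its `Υ₀₀`-row at `(t, x) = (0, 0)` reads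
`0 ≤ λ·d − ∂₀v₀(0) + Υ₀₀₀(0) = λ·d − 1`, where `d := derivWithin (V^#.Υ · 0 0 0) (Ici 0) 0` is ONE real
number (whatever its value, junk or not): `1 ≤ λ d` for all `λ ∈ (0, 1/4)` is impossible (`λ → 0`,
`no_uniform_barrier`). The subsolution is not even used. The charitable readings `Theorem2Barriers'`
(barriers may depend on `λ`) and `Theorem2BarriersHeywood` (compatible initial layer) are not touched by this
witness.

WHAT THIS IS NOT: not a claim about NS regularity or blow-up; not a claim about any author beyond the typed
locator.
-/

-- The summit's canonical theorem namespace repeats the summit name (single-conjunct summit).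
set_option linter.dupNamespace false

noncomputable section

open Set Function MeasureTheory Metric
open scoped ContDiff ENNReal Topology

namespace Summit.NavierStokesRegularity.NavierStokesRegularity.Theorems.Smith2006

open Literature.Claims.NS.Smith2006

/-! ### Elementary: no real `d` has `c ≤ λ·d` for all small `λ` when `c > 0` -/

/-- For `c > 0` and any real `d` there is `λ ∈ (0, 1/4)` with `λ·d < c`. [folklore] -/
theorem exists_small_lam (d c : ℝ) (hc : 0 < c) : ∃ lam ∈ Ioo (0 : ℝ) (1 / 4), lam * d < c := by
  refine ⟨min (1 / 8) (c / (2 * (|d| + 1))), ⟨?_, ?_⟩, ?_⟩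
  · positivity
  · have := min_le_left (1 / 8 : ℝ) (c / (2 * (|d| + 1))); linarith
  · have hm0 : 0 < min (1 / 8) (c / (2 * (|d| + 1))) := by positivity
    have hm : min (1 / 8) (c / (2 * (|d| + 1))) ≤ c / (2 * (|d| + 1)) := min_le_right _ _
    have hd : d ≤ |d| := le_abs_self d
    calc min (1 / 8) (c / (2 * (|d| + 1))) * d
        ≤ min (1 / 8) (c / (2 * (|d| + 1))) * (|d| + 1) := by nlinarith
      _ ≤ c / (2 * (|d| + 1)) * (|d| + 1) := by
          apply mul_le_mul_of_nonneg_right hm; positivity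
      _ = c / 2 := by field_simp
      _ < c := by linarith

/-- No single real number `d = ∂ₜΥ^#ᵢⱼ(t̂, x*)` satisfies `c ≤ λ·d` for every `λ ∈ (0, 1/4)` when `c > 0`.
[folklore] -/
theorem no_uniform_barrier (d c : ℝ) (hc : 0 < c) : ¬ ∀ lam ∈ Ioo (0 : ℝ) (1 / 4), c ≤ lam * d := by
  intro h
  obtain ⟨lam, hlam, hlt⟩ := exists_small_lam d c hc
  exact absurd (h lam hlam) (not_le.2 hlt)

/-! ### The admissible datum: a negative bump in the `Υ`-slots -/

/-- A smooth bump on `ℝ³`, equal to `1` on the closed unit ball, supported in the ball of radius `2`.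
[folklore] -/
def β : ContDiffBump (0 : R3) := ⟨1, 2, one_pos, one_lt_two⟩

/-- `β 0 = 1`. [folklore] -/
theorem β_zero : (β : R3 → ℝ) 0 = 1 :=
  β.one_of_mem_closedBall (mem_closedBall_self zero_le_one)

/-- A compactly supported smooth scalar has every derivative in `L²`. [folklore] -/
theorem lintegral_iteratedFDeriv_sq_lt_top_of_hasCompactSupport {g : R3 → ℝ} (hg : ContDiff ℝ ∞ g)
    (hcs : HasCompactSupport g) (n : ℕ) : ∫⁻ x, ‖iteratedFDeriv ℝ n g x‖ₑ ^ 2 < ⊤ := by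
  have hc : Continuous (iteratedFDeriv ℝ n g) :=
    hg.continuous_iteratedFDeriv (by exact_mod_cast le_top)
  have hK : HasCompactSupport (iteratedFDeriv ℝ n g) := hcs.iteratedFDeriv n
  have hsq : Continuous fun x => ‖iteratedFDeriv ℝ n g x‖ ^ 2 := hc.norm.pow 2
  have hKsq : HasCompactSupport fun x => ‖iteratedFDeriv ℝ n g x‖ ^ 2 :=
    hK.comp_left (g := fun m => ‖m‖ ^ 2) (by simp)
  have hi : Integrable (fun x => ‖iteratedFDeriv ℝ n g x‖ ^ 2) := hsq.integrable_of_hasCompactSupport hKsq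
  calc ∫⁻ x, ‖iteratedFDeriv ℝ n g x‖ₑ ^ 2 = ∫⁻ x, ENNReal.ofReal (‖iteratedFDeriv ℝ n g x‖ ^ 2) := by
        refine lintegral_congr fun x => ?_
        rw [ENNReal.ofReal_pow (norm_nonneg _), ofReal_norm]
    _ < ⊤ := hi.lintegral_lt_top

/-- The zero scalar is in `C^∞ ∩ H^∞`. [folklore] -/
theorem isHInftyScalar_zero : IsHInftyScalar (fun _ : R3 => (0 : ℝ)) := by
  refine ⟨contDiff_const, fun n => ?_⟩
  have h : iteratedFDeriv ℝ n (fun _ : R3 => (0 : ℝ)) = 0 := iteratedFDeriv_fun_zero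
  simp [h]

/-- The negative bump `−β` is in `C^∞ ∩ H^∞`. [folklore] -/
theorem isHInftyScalar_negBump : IsHInftyScalar (fun x : R3 => -(β : R3 → ℝ) x) := by
  refine ⟨β.contDiff.neg, fun n => ?_⟩
  exact lintegral_iteratedFDeriv_sq_lt_top_of_hasCompactSupport β.contDiff.neg
    (β.hasCompactSupport.comp_left (g := fun r : ℝ => -r) neg_zero) n

/-- The datum `W₀ = (0, 0, Υ₀)`, `Υ₀ᵢⱼ = −β` for all `i, j`. [folklore] -/
def W₀ : AuxData :=
  ⟨fun _ => 0, fun _ _ => 0, fun x _ _ => -(β : R3 → ℝ) x⟩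

/-- `W₀` is admissible (`C^∞ ∩ H^∞` componentwise). [folklore] -/
theorem W₀_isAdmissible : W₀.IsAdmissible :=
  ⟨isHInftyScalar_zero, fun _ => isHInftyScalar_zero, fun _ _ => isHInftyScalar_negBump⟩

/-! ### Step 2 (literal) is false -/

/-- **C06, Step 2 as printed is false.** `Theorem2Barriers` (Thm 2 (1)–(4) pp. 3–4 of arXiv:math/0609740
v4, literal item (3): one λ-independent pair of C² barriers with the data `W₀` at `t̂` for all
`λ ∈ (0, 1/4)`) fails at `t̂ = 0`, `S = [0, ∞)`, `F = 0`, `W₀ = (0, 0, −β)`: the `Υ₀₀`-row of the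
supersolution at `(0, 0)` would give `1 ≤ λ · ∂ₜΥ^#₀₀(0, 0)` for every `λ ∈ (0, 1/4)`.
[cite: Smith2006, Thm 2 (3) pp.3–4] -/
theorem not_Theorem2Barriers : ¬ Theorem2Barriers := by
  intro h
  obtain ⟨Vsup, Usub, M, hV, -, hsign⟩ :=
    h 0 (Ici 0) W₀ AuxForce.zero le_rfl (isTimeSlab_Ici 0) W₀_isAdmissible (AuxForce.isAdmissible_zero _)
  obtain ⟨-, -, hslice, -, -⟩ := hV
  have hv0 : Vsup.v 0 = fun _ _ => 0 := congrArg AuxData.v₀ hslice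
  have hΥ0 : Vsup.Υ 0 = fun x _ _ => -(β : R3 → ℝ) x := congrArg AuxData.Υ₀ hslice
  have key : ∀ lam ∈ Ioo (0 : ℝ) (1 / 4), 1 ≤ lam * derivWithin (fun s => Vsup.Υ s 0 0 0) (Ici 0) 0 := by
    rintro lam ⟨h0, h1⟩
    have hres : 0 ≤ auxResidualΥ lam (Ici 0) Vsup 0 0 0 0 :=
      ((hsign lam h0 h1).1 0 (by simp) 0).2.2 0 0
    have hpd : pd (fun y => Vsup.v 0 y 0) 0 0 = 0 := by
      simp [pd, hv0]
    have hY : Vsup.Υ 0 0 0 0 = -1 := by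
      rw [hΥ0]; simp [β_zero]
    unfold auxResidualΥ at hres
    rw [hpd, hY] at hres
    linarith
  exact no_uniform_barrier _ 1 one_pos key

end Summit.NavierStokesRegularity.NavierStokesRegularity.Theorems.Smith2006

end
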